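import Literature.Analysis.FluidPDE.OnsagerBDSVBiotSavart
import Literature.Analysis.FluidPDE.Antidivergence
import HarnessLib

/-!
# The BDSV gluing stage: the potential-theory inputs of §4.4 (named facts)

Buckmaster–De Lellis–Székelyhidi–Vicol (BDSV), *Onsager's conjecture for admissible weak
solutions*, CPAM 72 (2019) = arXiv:1701.08678, estimate the glued Reynolds stress
`R̊̄_q = ∂ₜχᵢ ℛ(vᵢ - vᵢ₊₁) - χᵢ(1-χᵢ)(vᵢ - vᵢ₊₁) ⊗̊ (vᵢ - vᵢ₊₁)` (§4.2) in Prop. 4.3 by writing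
`vᵢ - vᵢ₊₁ = curl (zᵢ - zᵢ₊₁)`, "Note that `ℛ curl` is a zero-order operator" (proof of Prop. 4.3,
§4.4), and invoking two results of their appendices:

* **App. C, Prop. C.1** ("Fix `α ∈ (0,1)`. Periodic Calderón–Zygmund operators are bounded on the
  space of zero mean `T³`-periodic `C^α` functions", quoted from Calderón–Zygmund 1954), used
  through the remark of §3.2 (proof of Prop. 3.3): "recall that `∂ᵢ∂ⱼ(-Δ)⁻¹` is given by
  `⅓ δᵢⱼ +` a Calderón–Zygmund operator";
* **App. D, Prop. D.1** (a variant of Constantin 2015, Lemma 1): for `α ∈ (0,1)`, `N ≥ 0`, a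
  Calderón–Zygmund operator `T_K` and a vector field `b ∈ C^{N+1,α}(T³)`,
  `‖[T_K, b·∇] f‖_{N+α} ≲ ‖b‖_{1+α} ‖f‖_{N+α} + ‖b‖_{N+1+α} ‖f‖_α` for `f ∈ C^{N+α}(T³)`, the
  implicit constant depending on `α, N, K`.

Neither Mathlib nor `Literature` has Calderón–Zygmund or Schauder theory in Hölder spaces (searched
`Calderon|Schauder|rieszTransform|HolderWith.*invLaplacian`: only `L^p` facts and the CET mollifier
commutator `TorusCommutatorEstimate`). This file

* names the concrete zero-order operators through which both results enter §§3–4: the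
  **second Riesz transforms** `∂ᵢ∂ⱼΔ⁻¹` of the flat torus (`BDSV.rieszHessian i j f`, with the
  accepted mean-zero inverse Laplacian `Torus.invLaplacian`), proves their elementary calculus
  (smoothness, symmetry in `i, j`, linearity, `∑ᵢ ∂ᵢ∂ᵢΔ⁻¹ f = f - ∫ f`, coordinates) and the
  identity behind "ℛ curl is a zero-order operator":
  `(ℛ curl z)ᵢⱼ = (curl ∂ᵢΔ⁻¹z)ⱼ + (curl ∂ⱼΔ⁻¹z)ᵢ` (`BDSV.antidivergence_curl`, with the accepted
  De Lellis–Székelyhidi antidivergence `Torus.antidivergence`), each entry of `curl ∂ᵢΔ⁻¹z` being a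
  difference of two second Riesz transforms of components of `z` (`BDSV.curl_partialDeriv_invLaplacian_apply`);
* transcribes Prop. C.1 (for these operators) and Prop. D.1 (for these operators) as **named
  facts** (`def … : Prop`, D-0014): `BDSV.holderCZBound`, `BDSV.commutatorCZBound`, with the
  accepted norms `Torus.eContDiffHolderNorm N α` (`∑_{j≤N} ‖Dʲ·‖_∞ + [D^N·]_α` of the periodic
  lift, App. A) and the accepted `Torus.convect b f = (b·∇)f`.

These are the two analytic inputs of the discharge of `BDSV.gluedTripleEstimates`
(`OnsagerBDSVGluing.lean`) that lie outside the paper; the same operators carry Prop. C.1 into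
§3.2 (`∇(p_ℓ - pᵢ)` through `∂ᵢ∂ⱼΔ⁻¹ div div`) and §3.3 ("`∇ℬ` is a bounded operator on Hölder
spaces", `∇ℬ = -∇Δ⁻¹ curl`).

## Design choices

* Prop. C.1 is transcribed for smooth `f` without the zero-mean proviso: `Δ⁻¹` annihilates
  constants, so `∂ᵢ∂ⱼΔ⁻¹ f = ∂ᵢ∂ⱼΔ⁻¹ (f - ∫f)` and `‖f - ∫f‖_{C^{0,α}} ≤ 2‖f‖_{C^{0,α}}`; the printed
  statement for zero-mean `C^α` functions thus gives the transcribed one (constant doubled), and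
  smooth functions are the only arguments in BDSV §§3–4.
* Prop. D.1 is transcribed verbatim (all `N`, tame right-hand side) for `T_K ↦ ∂ᵢ∂ⱼΔ⁻¹`; the
  local part `⅓δᵢⱼ` of `∂ᵢ∂ⱼ(-Δ)⁻¹` commutes with `b·∇` up to the constant `∫ (b·∇)f`, whose norm
  is within the right-hand side, so the printed statement covers these operators. No
  divergence-free assumption on `b` (none is printed).
* Constants are `ℝ≥0` (coerced into `ℝ≥0∞`, where the accepted norms live); exponents `α` are
  `ℝ≥0` with `0 < α < 1` as printed.

## References

* T. Buckmaster, C. De Lellis, L. Székelyhidi Jr., V. Vicol, *Onsager's conjecture for admissible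
  weak solutions*, Comm. Pure Appl. Math. 72 (2019) 229–274 = arXiv:1701.08678: §3.2 (proof of
  Prop. 3.3: `∂ᵢ∂ⱼ(-Δ)⁻¹ = ⅓δᵢⱼ + CZ`), §4.2 (4.4) (`ℛ`), §4.4 (proof of Prop. 4.3), App. C
  Prop. C.1, App. D Prop. D.1.
* A. P. Calderón, A. Zygmund, *Singular integrals and periodic functions*, Studia Math. 14 (1954)
  249–271 (the reference `[CaZy1954]` of Prop. C.1).
* P. Constantin, *Lagrangian–Eulerian methods for uniqueness in hydrodynamic systems*, Adv. Math.
  278 (2015) 67–102, Lemma 1 (the reference `[Co2015]` of Prop. D.1).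
-/

noncomputable section

open MeasureTheory Set Filter Function
open scoped ContDiff NNReal ENNReal

namespace Literature.Analysis.FluidPDE

namespace BDSV

open FunctionSpaces FunctionSpaces.Torus

/-- The flat three-torus `T³ = (ℝ/ℤ)³`, local notation. -/
local notation "𝕋³" => UnitAddTorus (Fin 3)

/-- Euclidean `ℝ³`, local notation. -/
local notation "ℝ³" => EuclideanSpace ℝ (Fin 3)

/-! ## The second Riesz transforms `∂ᵢ∂ⱼΔ⁻¹` -/

section RieszHessian

variable {F : Type*} [NormedAddCommGroup F] [NormedSpace ℝ F]

/-- The **second Riesz transform** `∂ᵢ∂ⱼΔ⁻¹ f = -RᵢRⱼ f` on `T³` (`Rᵢ = ∂ᵢ(-Δ)^{-1/2}`; BDSV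
§3.2: "`∂ᵢ∂ⱼ(-Δ)⁻¹` is given by `⅓δᵢⱼ +` a Calderón–Zygmund operator"), with the accepted
mean-zero inverse Laplacian `Torus.invLaplacian` and partial derivatives `Torus.partialDeriv`; a
Fourier multiplier of order zero (symbol `kᵢkⱼ/|k|²` off the zero mode, `0` at `k = 0`).
[cite: BuckmasterEtAl2018, §3.2 (proof of Prop. 3.3)] -/
def rieszHessian (i j : Fin 3) (f : 𝕋³ → F) : 𝕋³ → F :=
  partialDeriv i (partialDeriv j (invLaplacian f))

variable {i j : Fin 3} {f g : 𝕋³ → F}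

/-- Unfolding `∂ᵢ∂ⱼΔ⁻¹`. [folklore] -/
theorem rieszHessian_def (i j : Fin 3) (f : 𝕋³ → F) :
    rieszHessian i j f = partialDeriv i (partialDeriv j (invLaplacian f)) :=
  rfl

/-- `∂ᵢ∂ⱼΔ⁻¹ f` is smooth for smooth `f`. [folklore] -/
theorem isSmooth_rieszHessian (hf : IsSmooth f) (i j : Fin 3) : IsSmooth (rieszHessian i j f) :=
  ((isSmooth_invLaplacian hf).partialDeriv j).partialDeriv i

/-- Symmetry `∂ᵢ∂ⱼΔ⁻¹ f = ∂ⱼ∂ᵢΔ⁻¹ f` (Schwarz). [folklore] -/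
theorem rieszHessian_comm (hf : IsSmooth f) (i j : Fin 3) (x : 𝕋³) :
    rieszHessian i j f x = rieszHessian j i f x :=
  partialDeriv_comm (isSmooth_invLaplacian hf) i j x

/-- `∂ᵢ∂ⱼΔ⁻¹ f = ∂ᵢΔ⁻¹(∂ⱼ f)`: derivatives commute with `Δ⁻¹`. [folklore] -/
theorem rieszHessian_eq_partialDeriv_invLaplacian_partialDeriv (hf : IsSmooth f) (i j : Fin 3)
    (x : 𝕋³) : rieszHessian i j f x = partialDeriv i (invLaplacian (partialDeriv j f)) x := by
  rw [rieszHessian]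
  congr 1
  exact funext (partialDeriv_invLaplacian hf j)

/-- `∂ᵢ∂ⱼΔ⁻¹ f = Δ⁻¹(∂ᵢ∂ⱼ f)`: derivatives commute with `Δ⁻¹`. [folklore] -/
theorem rieszHessian_eq_invLaplacian_partialDeriv_partialDeriv (hf : IsSmooth f) (i j : Fin 3)
    (x : 𝕋³) : rieszHessian i j f x = invLaplacian (partialDeriv i (partialDeriv j f)) x := by
  rw [rieszHessian_eq_partialDeriv_invLaplacian_partialDeriv hf,
    partialDeriv_invLaplacian (hf.partialDeriv j) i x]

/-- `∂ᵢ∂ⱼΔ⁻¹ 0 = 0`. [folklore] -/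
theorem rieszHessian_zero (i j : Fin 3) : rieszHessian i j (0 : 𝕋³ → F) = 0 := by
  rw [rieszHessian, invLaplacian_zero]
  funext x
  simp [FunctionSpaces.Torus.partialDeriv, FunctionSpaces.Torus.lineDeriv]

/-- Additivity of `∂ᵢ∂ⱼΔ⁻¹` on smooth functions. [folklore] -/
theorem rieszHessian_add (hf : IsSmooth f) (hg : IsSmooth g) (i j : Fin 3) :
    rieszHessian i j (f + g) = rieszHessian i j f + rieszHessian i j g := by
  have h1 : IsContDiff 1 (invLaplacian f) := (isSmooth_invLaplacian hf).isContDiff (by simp)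
  have h2 : IsContDiff 1 (invLaplacian g) := (isSmooth_invLaplacian hg).isContDiff (by simp)
  have h3 : IsContDiff 1 (partialDeriv j (invLaplacian f)) :=
    ((isSmooth_invLaplacian hf).partialDeriv j).isContDiff (by simp)
  have h4 : IsContDiff 1 (partialDeriv j (invLaplacian g)) :=
    ((isSmooth_invLaplacian hg).partialDeriv j).isContDiff (by simp)
  rw [rieszHessian, invLaplacian_add hf hg, partialDeriv_add h1 h2, partialDeriv_add h3 h4]
  rfl

/-- Homogeneity of `∂ᵢ∂ⱼΔ⁻¹` on smooth functions. [folklore] -/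
theorem rieszHessian_const_smul (hf : IsSmooth f) (c : ℝ) (i j : Fin 3) :
    rieszHessian i j (c • f) = c • rieszHessian i j f := by
  have h1 : IsContDiff 1 (invLaplacian f) := (isSmooth_invLaplacian hf).isContDiff (by simp)
  have h3 : IsContDiff 1 (partialDeriv j (invLaplacian f)) :=
    ((isSmooth_invLaplacian hf).partialDeriv j).isContDiff (by simp)
  rw [rieszHessian, invLaplacian_const_smul c f hf, partialDeriv_const_smul h1, partialDeriv_const_smul h3]
  rfl

/-- `∂ᵢ∂ⱼΔ⁻¹ (-f) = -∂ᵢ∂ⱼΔ⁻¹ f` for smooth `f`. [folklore] -/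
theorem rieszHessian_neg (hf : IsSmooth f) (i j : Fin 3) :
    rieszHessian i j (-f) = -rieszHessian i j f := by
  rw [← neg_one_smul ℝ f, rieszHessian_const_smul hf, neg_one_smul]

/-- `∂ᵢ∂ⱼΔ⁻¹ (f - g) = ∂ᵢ∂ⱼΔ⁻¹ f - ∂ᵢ∂ⱼΔ⁻¹ g` for smooth `f, g`. [folklore] -/
theorem rieszHessian_sub (hf : IsSmooth f) (hg : IsSmooth g) (i j : Fin 3) :
    rieszHessian i j (f - g) = rieszHessian i j f - rieszHessian i j g := by
  rw [sub_eq_add_neg, rieszHessian_add hf hg.neg, rieszHessian_neg hg, sub_eq_add_neg]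

/-- `∂ᵢ∂ⱼΔ⁻¹` commutes with continuous linear maps of the values (it acts componentwise). [folklore] -/
theorem rieszHessian_clm_comp {G : Type*} [NormedAddCommGroup G] [NormedSpace ℝ G] [CompleteSpace F]
    [CompleteSpace G] (hf : IsSmooth f) (L : F →L[ℝ] G) (i j : Fin 3) (x : 𝕋³) :
    rieszHessian i j (L ∘ f) x = L (rieszHessian i j f x) := by
  rw [rieszHessian, rieszHessian, invLaplacian_clm_comp hf L,
    show partialDeriv j (L ∘ invLaplacian f) = L ∘ partialDeriv j (invLaplacian f) from
      funext fun y => partialDeriv_clm_comp (isSmooth_invLaplacian hf) L j y,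
    partialDeriv_clm_comp ((isSmooth_invLaplacian hf).partialDeriv j) L i x]

/-- Coordinates of `∂ᵢ∂ⱼΔ⁻¹` of a vector field: `∂ᵢ∂ⱼΔ⁻¹ (z_b) = (∂ᵢ∂ⱼΔ⁻¹ z)_b`. [folklore] -/
theorem rieszHessian_apply_coord {z : 𝕋³ → ℝ³} (hz : IsSmooth z) (i j : Fin 3) (x : 𝕋³)
    (b : Fin 3) : rieszHessian i j (fun y => z y b) x = rieszHessian i j z x b := by
  have h : (fun y => z y b) = (EuclideanSpace.proj b : ℝ³ →L[ℝ] ℝ) ∘ z := rfl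
  rw [h, rieszHessian_clm_comp hz]
  rfl

/-- **The trace of the Riesz–Hessian matrix**: `∑ᵢ ∂ᵢ∂ᵢΔ⁻¹ f = Δ Δ⁻¹ f = f - ∫ f` for smooth real
`f` (the accepted `Torus.laplacian_invLaplacian`; the local part `⅓δᵢⱼ` of BDSV's
decomposition `∂ᵢ∂ⱼ(-Δ)⁻¹ = ⅓δᵢⱼ + CZ`). [cite: BuckmasterEtAl2018, §3.2 (proof of Prop. 3.3)] -/
theorem sum_rieszHessian_diag {f : 𝕋³ → ℝ} (hf : IsSmooth f) (x : 𝕋³) :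
    ∑ i, rieszHessian i i f x = f x - ∫ y, f y := by
  simp only [rieszHessian]
  rw [← laplacian_eq_sum_partialDeriv_partialDeriv (isSmooth_invLaplacian hf), laplacian_invLaplacian hf]

end RieszHessian

/-! ## `ℛ ∘ curl` through second Riesz transforms -/

section AntidivCurl

variable {z : 𝕋³ → ℝ³}

/-- Entries of `curl ∂ᵢΔ⁻¹ z`: e.g. `(curl ∂ᵢΔ⁻¹z)₀ = ∂ᵢ∂₁Δ⁻¹ z₂ - ∂ᵢ∂₂Δ⁻¹ z₁`, and cyclically —
each a difference of two second Riesz transforms of components of `z`. [folklore] -/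
theorem curl_partialDeriv_invLaplacian_apply (hz : IsSmooth z) (i : Fin 3) (x : 𝕋³) :
    curl (partialDeriv i (invLaplacian z)) x =
      WithLp.toLp 2 ![rieszHessian i 1 z x 2 - rieszHessian i 2 z x 1,
        rieszHessian i 2 z x 0 - rieszHessian i 0 z x 2,
        rieszHessian i 0 z x 1 - rieszHessian i 1 z x 0] := by
  have hw : IsSmooth (invLaplacian z) := isSmooth_invLaplacian hz
  have hc : ∀ a b : Fin 3, partialDeriv a (partialDeriv i (invLaplacian z)) x b = rieszHessian i a z x b := by
    intro a b
    rw [rieszHessian, partialDeriv_comm hw a i x]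
  ext k
  fin_cases k
  · simp [curl_apply_zero, hc]
  · simp [curl_apply_one, hc]
  · simp [curl_apply_two, hc]

/-- The potentials of `ℛ(curl z)`: `Δ⁻¹ (curl z)ⱼ = (curl Δ⁻¹z)ⱼ`. [folklore] -/
theorem antidivPotential_curl (hz : IsSmooth z) (j : Fin 3) :
    Torus.antidivPotential (curl z) j = fun y => curl (invLaplacian z) y j := by
  have h : (fun x => curl z x j) = (EuclideanSpace.proj j : ℝ³ →L[ℝ] ℝ) ∘ curl z := rfl
  unfold Torus.antidivPotential
  rw [h, invLaplacian_clm_comp (isSmooth_curl hz)]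
  funext y
  rw [comp_apply, show invLaplacian (curl z) y = curl (invLaplacian z) y from invLaplacian_curl hz y]
  rfl

/-- `div Δ⁻¹ curl z = 0`: the divergence potential of `ℛ(curl z)` vanishes. [folklore] -/
theorem antidivDiv_curl (hz : IsSmooth z) (x : 𝕋³) : Torus.antidivDiv (curl z) x = 0 := by
  unfold Torus.antidivDiv
  simp only [antidivPotential_curl hz]
  exact divergence_curl (isSmooth_invLaplacian hz) x

/-- `Δ⁻¹ div Δ⁻¹ curl z = 0`: the scalar potential of `ℛ(curl z)` vanishes. [folklore] -/
theorem antidivPhi_curl (hz : IsSmooth z) : Torus.antidivPhi (curl z) = 0 := by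
  unfold Torus.antidivPhi
  rw [show Torus.antidivDiv (curl z) = 0 from funext (antidivDiv_curl hz), invLaplacian_zero]

/-- **"`ℛ curl` is a zero-order operator"** (BDSV §4.4, proof of Prop. 4.3): for smooth `z` on
`T³`, the De Lellis–Székelyhidi antidivergence of `curl z` is
`(ℛ curl z)ᵢⱼ = (curl ∂ᵢΔ⁻¹ z)ⱼ + (curl ∂ⱼΔ⁻¹ z)ᵢ` — a fixed linear combination of second Riesz
transforms `∂ₐ∂_bΔ⁻¹` of the components of `z` (`BDSV.curl_partialDeriv_invLaplacian_apply`), the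
terms `δᵢⱼ div Δ⁻¹v` and `∂ᵢ∂ⱼΔ⁻² div v` of `ℛv` vanishing for `v = curl z`. Entries are read in the
column convention of `Torus.antidivergence` (`ℛv x j i = (ℛv)ᵢⱼ`). [cite: BuckmasterEtAl2018, §4.4 (proof of Prop. 4.3)] -/
theorem antidivergence_curl (hz : IsSmooth z) (x : 𝕋³) (i j : Fin 3) :
    Torus.antidivergence (curl z) x j i =
      curl (partialDeriv i (invLaplacian z)) x j + curl (partialDeriv j (invLaplacian z)) x i := by
  have hw : IsSmooth (invLaplacian z) := isSmooth_invLaplacian hz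
  have hcw : IsSmooth (curl (invLaplacian z)) := isSmooth_curl hw
  have hpot : ∀ a b : Fin 3, partialDeriv a (Torus.antidivPotential (curl z) b) x =
      curl (partialDeriv a (invLaplacian z)) x b := by
    intro a b
    rw [antidivPotential_curl hz b, partialDeriv_apply_coord (hcw.isContDiff (by simp)) a x b,
      partialDeriv_curl hw a x]
  have hphi : partialDeriv i (partialDeriv j (Torus.antidivPhi (curl z))) x = 0 := by
    rw [antidivPhi_curl hz]
    simp [FunctionSpaces.Torus.partialDeriv, FunctionSpaces.Torus.lineDeriv]
  rw [Torus.antidivergence_apply, Torus.antidivEntry, hpot, hpot, hphi, antidivDiv_curl hz x]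
  simp

end AntidivCurl

/-! ## The two named facts -/

section Facts

/-- **Periodic Calderón–Zygmund operators on Hölder spaces** (BDSV App. C, Prop. C.1: "Fix
`α ∈ (0,1)`. Periodic Calderón–Zygmund operators are bounded on the space of zero mean
`T³`-periodic `C^α` functions", after Calderón–Zygmund 1954), for the operators through which it
is used in §§3–4 (§3.2: "`∂ᵢ∂ⱼ(-Δ)⁻¹` is given by `⅓δᵢⱼ +` a Calderón–Zygmund operator"; §4.4:
"`ℛ curl` is a zero-order operator", cf. `BDSV.antidivergence_curl`). Transcription: for
`0 < α < 1` there is `C = C(α)` such that for all `i, j` and every smooth real `f` on `T³`,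
`‖∂ᵢ∂ⱼΔ⁻¹ f‖_{C^{0,α}} ≤ C ‖f‖_{C^{0,α}}`, norms being the accepted `Torus.eContDiffHolderNorm 0 α`
(`‖·‖_∞ + [·]_α` of the periodic lift, App. A). The zero-mean proviso is immaterial for `Δ⁻¹`
(which annihilates constants; `‖f - ∫f‖_{C^{0,α}} ≤ 2‖f‖_{C^{0,α}}`), and smooth functions are
`C^α`. [cite: BuckmasterEtAl2018, App. C Prop. C.1] -/
def holderCZBound : Prop :=
  ∀ α : ℝ≥0, 0 < α → α < 1 → ∃ C : ℝ≥0, ∀ (i j : Fin 3) (f : 𝕋³ → ℝ), IsSmooth f →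
    Torus.eContDiffHolderNorm 0 α (rieszHessian i j f) ≤ C * Torus.eContDiffHolderNorm 0 α f

/-- **Commutator of a Calderón–Zygmund operator with a transport operator** (BDSV App. D,
Prop. D.1, "a variant of Lemma 1 from [Co2015]" = Constantin 2015: "Let `α ∈ (0,1)` and `N ≥ 0`.
Let `T_K` be a Calderón–Zygmund operator with kernel `K`. Let `b ∈ C^{N+1,α}(T³)` a vectorfield.
Then `‖[T_K, b·∇] f‖_{N+α} ≲ ‖b‖_{1+α} ‖f‖_{N+α} + ‖b‖_{N+1+α} ‖f‖_α` for any `f ∈ C^{N+α}(T³)`,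
where the implicit constant depends on `α, N` and `K`"), for the operators `T = ∂ᵢ∂ⱼΔ⁻¹` of
`BDSV.holderCZBound` (used in §4.4 for `[v_ℓ·∇, ℛ curl]`). Transcription: for `0 < α < 1` and
`N` there is `C = C(α, N)` such that for all `i, j`, every smooth vector field `b` and smooth real
`f` on `T³`, `‖∂ᵢ∂ⱼΔ⁻¹((b·∇)f) - (b·∇)(∂ᵢ∂ⱼΔ⁻¹f)‖_{C^{N,α}} ≤ C (‖b‖_{C^{1,α}} ‖f‖_{C^{N,α}} + ‖b‖_{C^{N+1,α}} ‖f‖_{C^{0,α}})`,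
with `(b·∇)f = Torus.convect b f` and the accepted norms `Torus.eContDiffHolderNorm`; the local
part `⅓δᵢⱼ` of `∂ᵢ∂ⱼ(-Δ)⁻¹` contributes only the constant `∫(b·∇)f`, within the right-hand side.
[cite: BuckmasterEtAl2018, App. D Prop. D.1] -/
def commutatorCZBound : Prop :=
  ∀ α : ℝ≥0, 0 < α → α < 1 → ∀ N : ℕ, ∃ C : ℝ≥0, ∀ (i j : Fin 3) (b : 𝕋³ → ℝ³) (f : 𝕋³ → ℝ),
    IsSmooth b → IsSmooth f →
      Torus.eContDiffHolderNorm N α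
          (fun x => rieszHessian i j (Torus.convect b f) x - Torus.convect b (rieszHessian i j f) x) ≤
        C * (Torus.eContDiffHolderNorm 1 α b * Torus.eContDiffHolderNorm N α f +
          Torus.eContDiffHolderNorm (N + 1) α b * Torus.eContDiffHolderNorm 0 α f)

end Facts

end BDSV

end Literature.Analysis.FluidPDE
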